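import Literature.NumberTheory.Automorphic.WeaklyRegularGaloisRep
import Literature.NumberTheory.Automorphic.MokStandardBaseChangeDescentContinuation
import HarnessLib

/-!
# Fakhruddin–Pilloni, Thm. 9.7, corrected: oddness is a pole of the *continued* Asai
# `L`-function; the symplectic obstruction of the printed proof

Topic `NumberTheory/Automorphic`; namespace `Literature.NumberTheory.Automorphic`. Companion of
`WeaklyRegularGaloisRep` (the named fact `FakhruddinPilloni2021_odd_of_weaklyRegular`, N. Fakhruddin,
V. Pilloni, *Hecke operators and the coherent cohomology of Shimura varieties*, J. Inst. Math.
Jussieu 22 (2023) = arXiv:1910.03790, Thm. 9.7) and of `AsaiSignContinuation` /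
`MokStandardBaseChangeDescentContinuation` (the continuation currency of Asai poles). This file
declares theorems only (provefact unit for that fact, 2026-08-15/16, verdict `misstated`; a proving
seat may not mint a named fact, D-0026).

## The discrepancy

`FakhruddinPilloni2021_odd_of_weaklyRegular` renders Thm. 9.7 (arXiv p. 43): "Let `π` be a weakly
regular, algebraic, conjugate self dual, cuspidal automorphic representation of `GL_n / L` [`L` CM].
Let `λ = (λ_{i,τ})` be its infinitesimal character. Then `π` is automatically odd unless possibly
when `n` is even and for all `τ`, `λ_{i,τ} = λ_{i+n/2,τ}` for some ordering of the infinitesimal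
character", where (§9.1, p. 41) "the oddness condition is that
`L(s, Asai^{(-1)^{n-1} ε(χ₀)}(π) ⊗ χ₀⁻¹)` has a pole at `s = 1`" (`χ₀ = 1`, `ε(χ₀) = 1` for conjugate
self-dual `π`). The conclusion "`π` is odd" is rendered as `π.HasAsaiSign c 1`, i.e.
`π.HasAsaiPole c (-1)^{n+1}` of `AsaiSign`: for every Asai datum `(S, A)` of `π` the **raw** partial
Euler product `partialAsaiL S c A (-1)^{n+1}` — an unconditional `tprod`, with the junk value `1`
wherever it is not multipliable — satisfies `(s - 1) L^S(s) → r ≠ 0` as `s → 1` on `{1 < Re s}`.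
Fakhruddin–Pilloni's `L(s, Asai^±(π))` is the Asai `L`-function of Langlands–Shahidi / Flicker (their
proof: "This again follows from the results of [Mok]"; Mok's `L(s, φ^N, As^±)` have local factors
"studied in Goldberg [G], which are special cases of the `L`-functions studied by Shahidi [S]", Mok
p. 20), i.e. the **meromorphic continuation** of an Euler product absolutely convergent only "in some
right half-plane `Re(s) > C`" (Grbac–Shahidi 2015, §2.A; Flicker 1988, Theorem p. 297: "converges
absolutely, uniformly in compact subsets, in some right half-plane. It has meromorphic continuation
to the entire complex plane"). The rendering therefore additionally asserts that the raw partial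
Asai product is meaningful on `{1 < Re s}` near `1` and matches its continuation there; for `n ≥ 3`
this needs the convergence `∑_{v inert} |tr t_w| q_v^{-σ} < ∞` for `1 < σ ≤ 3/2`, which
Jacquet–Shalika's bounds over `L` (`q_w = q_v²`) give only for `σ > 3/2` (Cauchy–Schwarz) and which
would follow from the Ramanujan conjecture for `π` (unknown for weakly regular, non-regular `π`) or
from the automorphy of the Asai transfer to `GL_{n²}` (known for `n ≤ 2`). This is word for word the
discrepancy recorded for the same notion `HasAsaiPole` by the verdicts on
`Mok2014_partialAsaiL_pole_dichotomy` (deprecation note in `AsaiSign.lean`, module docstring of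
`AsaiSignContinuation.lean`) and on `Mok2014_standardBaseChange_descent`
(`MokStandardBaseChangeDescentContinuation.lean`). Hence the rendered fact is **stronger than print**
and is not derivable from the printed theorem even granted all of [Mok]: the printed proof (p. 44)
— "If `π` is not odd, we deduce that `L(s, Asai^{(-1)^n}(π))` has a pole at `s = 1`" (Mok's
dichotomy, §2.5), descent to `U(n)` through the twisted embedding `ξ₋` (Mok, Thms. 2.4.2, 2.4.10,
2.5.4 (a)), "For each place `v ∣ ∞` the parameter of `π_v` … is conjugated to
`z ↦ diag((z/z̄)^{λ_{1,v}}, ⋯, (z/z̄)^{λ_{n,v}})`. For `π_v` to descend via the twisted `L`-group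
embedding, there should exist a non degenerate symplectic form `A` on `ℂⁿ` such that
`ᵗρ_v(z̄) A ρ_v(z) = A` for all `z ∈ ℂ^×`. It is easy to see that there is no such symplectic form,
unless when `n` is even and `λ_{i,v} = λ_{i+n/2,v}` for some ordering of the `(λ_{i,v})`" — produces
a pole of the *continued* `L`-function and says nothing about the raw product on `1 < Re s ≤ C`.
(The theorem itself is in any case far beyond an inline proof: its inputs are Mok's endoscopic
classification — the "seed theorem" 2.4.2 "proved by induction and comparison of trace formulas",
Mok p. 13 — the archimedean local Langlands correspondence for `GL_n(ℂ)` and Clozel's purity; none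
is in Mathlib or in `Literature/`.)

## What is vendored here

* The **corrected Theorem 9.7** (called `FakhruddinPilloni2021_oddCont_of_weaklyRegular` in the
  accompanying notes; it is *not* declared as a `def` here — D-0026 — but appears verbatim as the
  hypothesis `h97` of the reductions below, exactly as the corrected Mok statements appear as the
  hypotheses `h` / right-hand side `D'` of `Mok2014_partialAsaiL_pole_dichotomy_of_continuation` and
  `Mok2014_standardBaseChange_descent_iff_continuation`): same hypotheses and same exceptional
  configuration as `FakhruddinPilloni2021_odd_of_weaklyRegular` (`K` CM with complex conjugation
  `c = IsCMField.complexConj K` over `K⁺ = maximalRealSubfield K`; `π` a cuspidal Borel–Jacquet datum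
  on `GL_n(𝔸_K)` with a C-algebraic, weakly regular infinity type `T`; `IsEssConjSelfDual π 1`;
  exception `T.IsEvenlyPaired`), conclusion "odd" in CONTINUATION form — verbatim the clause `D'` of
  the corrected Mok descent with `N = n`, `E = K`, `F = K⁺`: for every Asai datum `(S, A)` of `π`
  there is `σ₀ ≥ 1` with the partial `As^{(-1)^{n-1}}` Euler product multipliable on `Re s > σ₀` and
  a function `G` holomorphic on `{1/2 < Re s}` with `G(s) = (s - 1) L^S(s, π, As^{(-1)^{n-1}})` for
  `Re s > σ₀` and `G(1) ≠ 0` (the continued partial Asai `L`-function has a simple pole at `s = 1`;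
  by Mok's dichotomy a pole at `1` is simple, and the partial function carries the pole of the
  complete one, the omitted local factors being entire and nowhere zero — see the docstring of
  `Mok2014_standardBaseChange_descent_iff_continuation`):

      ∀ (n : ℕ) (K : Type) [Field K] [NumberField K] [IsCMField K]
        (hcpt : isCompact_glFiniteIntegralLevel n K) (π : CuspidalAutomorphicRepData n K hcpt)
        (T : InfinityType K n), π.1.HasInfinityType T → T.IsCAlgebraic → T.IsWeaklyRegular →
          π.1.IsEssConjSelfDual 1 →
            (∀ (S : Set (HeightOneSpectrum (𝓞 (maximalRealSubfield K)))) (A : SatakeFamily K),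
                π.1.IsAsaiDatum (IsCMField.complexConj K) S A →
                  ∃ σ₀ : ℝ, 1 ≤ σ₀ ∧
                    (∀ s : ℂ, σ₀ < s.re → Multipliable fun v : {v // v ∉ S} =>
                      ((asaiLocalPolynomial (IsCMField.complexConj K) A ((-1) ^ (n + 1))
                        (placeAbove K v.1)).eval ((v.1.residueCard : ℂ) ^ (-s)))⁻¹) ∧
                    ∃ G : ℂ → ℂ, DifferentiableOn ℂ G {s : ℂ | 1 / 2 < s.re} ∧
                      (∀ s : ℂ, σ₀ < s.re → G s =
                        (s - 1) * partialAsaiL S (IsCMField.complexConj K) A ((-1) ^ (n + 1)) s) ∧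
                      G 1 ≠ 0) ∨
            T.IsEvenlyPaired

* `FakhruddinPilloni2021_odd_of_weaklyRegular_of_oddCont` — **proved reduction**: the corrected
  Thm. 9.7 (`h97`) together with the holomorphy, on the open half-plane `{1 < Re s}`, of the raw
  partial `As^{(-1)^{n-1}}` Euler products of conjugate self-dual cuspidal `π` over CM fields (the
  unpublished ingredient, verbatim the `hhol` of the Mok companions) implies the mis-stated rendering
  `FakhruddinPilloni2021_odd_of_weaklyRegular` verbatim (`AutomorphicRepData.hasAsaiPole_of_continuation`,
  identity theorem on `{1 < Re s}`). Pointwise and unconditionally for `π` satisfying the Ramanujan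
  bound at its unramified places: `hasAsaiSign_or_isEvenlyPaired_of_oddCont_of_norm_le_one`
  (`AutomorphicRepData.hasAsaiPole_of_continuation_of_norm_le_one`).
* `AutomorphicRepData.HasAsaiPole.exists_continuation_of_dichotomy` and
  `oddCont_or_isEvenlyPaired_of_odd` — **the converse direction, proved**: a raw pole at `η`, for a
  `π` whose raw product is holomorphic on `{1 < Re s}` and which satisfies the corrected dichotomy
  (per datum: verbatim the conclusion of the hypothesis `h` of
  `Mok2014_partialAsaiL_pole_dichotomy_of_continuation`), is a continued pole at `η` — the sign of
  the dichotomy cannot be `-η` (`HasAsaiPole.false_of_holomorphic_continuation`); hence the mis-stated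
  rendering gives back the corrected conclusion for such `π`. Together the two directions pin down
  what separates the rendering from print: the raw-versus-continued comparison on `1 < Re s ≤ C`.
* `FakhruddinPilloni2021_galoisRep_of_odd_count_of_oddCont` — corrected 9.7 + raw holomorphy for the
  given `π` + the vendored Thm. 9.10 (`FakhruddinPilloni2021_galoisRep_of_weaklyRegular_odd`, whose
  oddness HYPOTHESIS is the raw form) ⇒ the Galois representations under an odd-multiplicity
  exponent (the composite `FakhruddinPilloni2021_galoisRep_of_odd_count` re-based on print).
* **The one step of the printed proof that Fakhruddin–Pilloni carry out themselves, proved**: the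
  exceptional configuration as parities of multiplicities, `InfinityType.isEvenlyPaired_iff_even_count`
  ("`n` even and every exponent has even multiplicity at every embedding", with the multiset lemma
  `InfinityType.multiset_exists_eq_add_self_of_even_count`), and the symplectic obstruction
  `even_card_filter_eq_of_transpose_eq_neg_of_det_ne_zero` /
  `even_count_map_of_transpose_eq_neg_of_det_ne_zero`: an antisymmetric matrix with non-zero
  determinant which is block diagonal for a labelling of the indices (for `ᵗρ_v(z̄) A ρ_v(z) = A` with
  `ρ_v(z) = diag((z/z̄)^{λ_i})` the invariance reads `(z/z̄)^{λ_j-λ_i} A_{ij} = A_{ij}`, so `A_{ij} = 0`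
  unless `λ_i = λ_j`) has all label classes of even size (`Matrix.BlockTriangular.det` and
  `matrix_det_eq_zero_of_transpose_eq_neg_of_odd_card`: an antisymmetric matrix of odd size is
  singular) — "there is no such symplectic form, unless when `n` is even and `λ_{i,v} = λ_{i+n/2,v}`
  for some ordering". The passage from the printed invariance `ᵗρ_v(z̄) A ρ_v(z) = A`,
  `ρ_v(z) = diag((z/z̄)^{λ_i})` (the torus `diag(e^{2iθλ_i})` on `z = e^{iθ}`), to that
  block-diagonality is `matrix_apply_eq_zero_of_torus_invariant` (integral differences
  `λ_j - λ_i = k`, `θ = π/(2k)`); assembled: `even_card_and_exists_map_eq_add_self_of_torus_invariant`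
  and, for a C-algebraic infinity type over a number field,
  `InfinityType.isEvenlyPaired_of_symplectic_torus_invariant` (such an `A` at every embedding ⇒
  `IsEvenlyPaired`) — appended 2026-08-16.

Nothing of `WeaklyRegularGaloisRep` is touched; deprecating `FakhruddinPilloni2021_odd_of_weaklyRegular`
and vendoring the corrected statement as a named fact are left to the verdict clean-up / a cite
item, as was done for `Mok2014_partialAsaiL_pole_dichotomy`. The twin remark that the rendering of
Thm. 9.10 (`FakhruddinPilloni2021_galoisRep_of_weaklyRegular_odd`) takes the raw form as a
*hypothesis* — formally incomparable with the printed hypothesis for `n ≥ 3` — is recorded here only.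

## References

* N. Fakhruddin, V. Pilloni, *Hecke operators and the coherent cohomology of Shimura varieties*,
  J. Inst. Math. Jussieu 22 (2023), 1–69 = arXiv:1910.03790: §9.1 (p. 41, "Odd"), Thm. 9.7 (p. 43)
  and its proof (p. 44) (text read). [FakhruddinPilloni2021]
* C. P. Mok, *Endoscopic classification of representations of quasi-split unitary groups*,
  Mem. Amer. Math. Soc. 235 (2015), no. 1108 (arXiv:1206.0882): (2.2.6) and Lemma 2.2.1, Thm. 2.4.2,
  Thm. 2.4.10, §2.5 and Thm. 2.5.4 (a), the Corollary closing §2.5 (p. 21). [Mok2014]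
* N. Grbac, F. Shahidi, *Endoscopic transfer for unitary groups and holomorphy of Asai
  `L`-functions*, Pacific J. Math. 276 (2015), 185–211: §2.A, Thm. 4.3 (2). [GrbacShahidi2015]
* Y. Z. Flicker, *Twisted tensors and Euler products*, Bull. Soc. Math. France 116 (1988),
  295–313: Theorem p. 297. [Flicker1988]
-/

noncomputable section

open scoped NumberField
open NumberField IsDedekindDomain

namespace Literature.NumberTheory.Automorphic

/-! ### The exceptional configuration as parities of multiplicities -/

namespace InfinityType

variable {K : Type*} [Field K] {n : ℕ}

/-- A multiset all of whose multiplicities are even is a double: `s = μ + μ` (take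
`count a μ = count a s / 2`; a general multiset lemma, kept in this namespace). [folklore] -/
theorem multiset_exists_eq_add_self_of_even_count {α : Type*} [DecidableEq α]
    (s : Multiset α) (h : ∀ a, Even (s.count a)) : ∃ μ : Multiset α, s = μ + μ := by
  refine ⟨s.dedup.bind fun a => Multiset.replicate (s.count a / 2) a, ?_⟩
  ext a
  rw [Multiset.count_add, Multiset.count_bind]
  have hsum : (s.dedup.map fun b => Multiset.count a (Multiset.replicate (s.count b / 2) b)).sum =
      s.count a / 2 := by
    by_cases ha : a ∈ s
    · rw [← Multiset.cons_erase (Multiset.mem_dedup.mpr ha), Multiset.map_cons, Multiset.sum_cons,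
        Multiset.count_replicate_self]
      have h0 : ((s.dedup.erase a).map fun b =>
          Multiset.count a (Multiset.replicate (s.count b / 2) b)).sum = 0 := by
        refine Multiset.sum_eq_zero fun x hx => ?_
        obtain ⟨b, hb, rfl⟩ := Multiset.mem_map.mp hx
        have hba : b ≠ a := fun hba => by
          rw [hba] at hb
          exact (Multiset.nodup_dedup s).notMem_erase hb
        exact Multiset.count_eq_zero.mpr fun hmem => hba (Multiset.eq_of_mem_replicate hmem).symm
      rw [h0, add_zero]
    · have hc : s.count a = 0 := Multiset.count_eq_zero.mpr ha
      rw [hc, Nat.zero_div]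
      refine Multiset.sum_eq_zero fun x hx => ?_
      obtain ⟨b, _, rfl⟩ := Multiset.mem_map.mp hx
      refine Multiset.count_eq_zero.mpr fun hmem => ha ?_
      rw [Multiset.eq_of_mem_replicate hmem]
      by_contra hb
      rw [Multiset.count_eq_zero.mpr hb, Nat.zero_div, Multiset.replicate_zero] at hmem
      exact Multiset.notMem_zero _ hmem
  rw [hsum]
  obtain ⟨k, hk⟩ := h a
  omega

/-- **The exceptional configuration of Thm. 9.7 as parities of multiplicities**: an infinity type
is evenly paired iff `n` is even and, at every embedding, every exponent `λ_{i,τ}` occurs with even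
multiplicity — the form in which the printed proof arrives at it ("there should exist a non
degenerate symplectic form `A` on `ℂⁿ` such that `ᵗρ_v(z̄) A ρ_v(z) = A` … there is no such
symplectic form, unless when `n` is even and `λ_{i,v} = λ_{i+n/2,v}` for some ordering": `A` is
block diagonal on the eigenspaces of `ρ_v(z) = diag((z/z̄)^{λ_{i,v}})`, and a non-degenerate
alternating form lives only on even-dimensional spaces). [cite: FakhruddinPilloni2021, Thm. 9.7 (proof, arXiv p. 44)] -/
theorem isEvenlyPaired_iff_even_count (T : InfinityType K n) :
    T.IsEvenlyPaired ↔ Even n ∧ ∀ (σ : K →+* ℂ) (a : ℂ), Even (((T σ).map ArchWeight.a).count a) := by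
  classical
  constructor
  · rintro ⟨hn, hp⟩
    refine ⟨hn, fun σ a => ?_⟩
    obtain ⟨μ, hμ⟩ := hp σ
    rw [hμ, Multiset.count_add]
    exact ⟨_, rfl⟩
  · rintro ⟨hn, h⟩
    exact ⟨hn, fun σ => multiset_exists_eq_add_self_of_even_count _ (h σ)⟩

end InfinityType

/-! ### The symplectic obstruction of the printed proof of Thm. 9.7

The only step of the printed proof that Fakhruddin–Pilloni carry out themselves (everything else
being "the results of [Mok]"): "For `π_v` to descend via the twisted `L`-group embedding, there
should exist a non degenerate symplectic form `A` on `ℂⁿ` such that `ᵗρ_v(z̄) A ρ_v(z) = A` for all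
`z ∈ ℂ^×`. It is easy to see that there is no such symplectic form, unless when `n` is even and
`λ_{i,v} = λ_{i+n/2,v}` for some ordering of the `(λ_{i,v})`" (p. 44). With
`ρ_v(z) = diag((z/z̄)^{λ_{i,v}})` the invariance reads `(z/z̄)^{λ_j - λ_i} A_{ij} = A_{ij}`, i.e.
`A_{ij} = 0` unless `λ_i = λ_j` (`λ_j - λ_i ∈ ℤ`): `A` is block diagonal for the partition of the
indices by the values `λ_i`, and a non-degenerate antisymmetric block has even size. We prove this
matrix statement over any commutative ring without zero divisors of characteristic zero.
-/

section SymplecticObstruction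

open _root_.Matrix _root_.Finset

/-- **An antisymmetric square matrix of odd size is singular** (over a commutative ring of
characteristic zero without zero divisors): `det A = det Aᵀ = det (-A) = (-1)^{card} det A = -det A`.
[folklore] -/
theorem matrix_det_eq_zero_of_transpose_eq_neg_of_odd_card {R : Type*} [CommRing R]
    [NoZeroDivisors R] [CharZero R] {m : Type*} [Fintype m] [DecidableEq m] {A : Matrix m m R}
    (hA : A.transpose = -A) (hodd : Odd (Fintype.card m)) : A.det = 0 := by
  have h1 : A.det = -A.det := by
    conv_lhs => rw [← det_transpose, hA, det_neg, hodd.neg_one_pow]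
    simp
  have h2 : (2 : R) * A.det = 0 := by
    rw [two_mul]
    nth_rewrite 1 [h1]
    rw [neg_add_cancel]
  rcases mul_eq_zero.mp h2 with h | h
  · exact absurd h two_ne_zero
  · exact h

/-- **No non-degenerate symplectic form commuting with a diagonal torus unless every eigenvalue
multiplicity is even** (the linear algebra of the printed proof of Thm. 9.7, p. 44). Let
`lam : ι → β` label the rows of a square matrix `A` over a commutative ring of characteristic zero
without zero divisors; if `A` is antisymmetric (`Aᵀ = -A`), non-degenerate (`det A ≠ 0`) and block
diagonal for the partition by the values of `lam` (`A i j = 0` whenever `lam i ≠ lam j` — for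
`A` with `ᵗρ(z̄) A ρ(z) = A`, `ρ(z) = diag((z/z̄)^{λ_i})`, this is `(z/z̄)^{λ_j-λ_i} A_{ij} = A_{ij}`),
then every value `t` is taken by `lam` an even number of times: the determinant is the product of
the determinants of the diagonal blocks (Mathlib `Matrix.BlockTriangular.det`, the blocks indexed by
the finite image of `lam`, linearly ordered through `Fin`), and an antisymmetric block of odd size
is singular. [cite: FakhruddinPilloni2021, Thm. 9.7 (proof, arXiv p. 44)] -/
theorem even_card_filter_eq_of_transpose_eq_neg_of_det_ne_zero {R : Type*} [CommRing R]
    [NoZeroDivisors R] [CharZero R] {ι β : Type*} [Fintype ι] [DecidableEq ι] [DecidableEq β]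
    (lam : ι → β) {A : Matrix ι ι R} (hA : A.transpose = -A) (hdet : A.det ≠ 0)
    (hblock : ∀ i j, lam i ≠ lam j → A i j = 0) (t : β) :
    Even ((univ.filter fun i => lam i = t).card) := by
  classical
  by_cases ht : ∃ i₀, lam i₀ = t
  swap
  · -- a value that is not taken is taken zero times
    have h0 : (univ.filter fun i => lam i = t) = ∅ :=
      Finset.filter_eq_empty_iff.mpr fun i _ hi => ht ⟨i, hi⟩
    rw [h0, Finset.card_empty]
    exact ⟨0, rfl⟩
  obtain ⟨i₀, hi₀⟩ := ht
  -- label the blocks by the finite image of `lam`, linearly ordered through `Fin`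
  set S : Finset β := univ.image lam
  letI : LinearOrder S := LinearOrder.lift' (Fintype.equivFin S) (Fintype.equivFin S).injective
  let b : ι → S := fun i => ⟨lam i, mem_image_of_mem lam (mem_univ i)⟩
  have hb : ∀ i j, b i = b j ↔ lam i = lam j := fun i j => by
    simp only [b, Subtype.mk.injEq]
  have hBT : A.BlockTriangular b := fun i j hij =>
    hblock i j fun h => absurd ((hb i j).2 h) (ne_of_gt hij)
  -- the block of `t = lam i₀`
  set a : S := b i₀ with ha
  have hcard : Fintype.card {i // b i = a} = (univ.filter fun i => lam i = t).card := by
    rw [Fintype.card_subtype]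
    congr 1
    ext i
    simp only [mem_filter, mem_univ, true_and, ha, hb, hi₀]
  rw [← hcard]
  by_contra hodd
  rw [Nat.not_even_iff_odd] at hodd
  -- the diagonal block is antisymmetric of odd size, hence singular
  have hT : (A.toSquareBlock b a).transpose = -(A.toSquareBlock b a) := by
    ext i j
    have hij : A j.1 i.1 = -A i.1 j.1 := by
      rw [← transpose_apply A i.1 j.1, hA, Matrix.neg_apply]
    simpa [toSquareBlock_def, Matrix.transpose_apply, Matrix.neg_apply] using hij
  have h0 : (A.toSquareBlock b a).det = 0 :=
    matrix_det_eq_zero_of_transpose_eq_neg_of_odd_card hT hodd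
  -- and `det A` is the product of the determinants of the diagonal blocks
  apply hdet
  rw [hBT.det]
  exact Finset.prod_eq_zero (mem_image_of_mem b (mem_univ i₀)) h0

/-- Multiset form of `even_card_filter_eq_of_transpose_eq_neg_of_det_ne_zero`: every multiplicity of
the multiset of labels `{lam i}_i` is even — so it is a double `μ + μ`
(`InfinityType.multiset_exists_eq_add_self_of_even_count`), the exceptional configuration
`InfinityType.IsEvenlyPaired` of Thm. 9.7 at one embedding (`InfinityType.isEvenlyPaired_iff_even_count`).
[cite: FakhruddinPilloni2021, Thm. 9.7 (proof, arXiv p. 44)] -/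
theorem even_count_map_of_transpose_eq_neg_of_det_ne_zero {R : Type*} [CommRing R]
    [NoZeroDivisors R] [CharZero R] {ι β : Type*} [Fintype ι] [DecidableEq ι] [DecidableEq β]
    (lam : ι → β) {A : Matrix ι ι R} (hA : A.transpose = -A) (hdet : A.det ≠ 0)
    (hblock : ∀ i j, lam i ≠ lam j → A i j = 0) (t : β) :
    Even ((univ.val.map lam).count t) := by
  rw [Multiset.count_map]
  convert even_card_filter_eq_of_transpose_eq_neg_of_det_ne_zero lam hA hdet hblock t using 1
  rw [Finset.card_def, Finset.filter_val]
  congr 1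
  exact Multiset.filter_congr fun i _ => eq_comm

/-- The two previous statements combined in the form used by the printed proof: the multiset of
labels of an antisymmetric, non-degenerate, label-block-diagonal matrix is a double `μ + μ` — at an
archimedean place, "`λ_{i,v} = λ_{i+n/2,v}` for some ordering of the `(λ_{i,v})`".
[cite: FakhruddinPilloni2021, Thm. 9.7 (proof, arXiv p. 44)] -/
theorem exists_map_eq_add_self_of_transpose_eq_neg_of_det_ne_zero {R : Type*} [CommRing R]
    [NoZeroDivisors R] [CharZero R] {ι β : Type*} [Fintype ι] [DecidableEq ι] [DecidableEq β]
    (lam : ι → β) {A : Matrix ι ι R} (hA : A.transpose = -A) (hdet : A.det ≠ 0)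
    (hblock : ∀ i j, lam i ≠ lam j → A i j = 0) :
    ∃ μ : Multiset β, univ.val.map lam = μ + μ :=
  InfinityType.multiset_exists_eq_add_self_of_even_count _
    (even_count_map_of_transpose_eq_neg_of_det_ne_zero lam hA hdet hblock)

end SymplecticObstruction

/-! ### From the invariance `ᵗρ_v(z̄) A ρ_v(z) = A` to the exceptional configuration
(appended 2026-08-16, same provefact unit)

The printed condition is stated for the archimedean parameter itself: "there should exist a non
degenerate symplectic form `A` on `ℂⁿ` such that `ᵗρ_v(z̄) A ρ_v(z) = A` for all `z ∈ ℂ^×`", with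
`ρ_v(z) = diag((z/z̄)^{λ_{1,v}}, …, (z/z̄)^{λ_{n,v}})` (p. 44). For `z = r e^{iθ}` one has
`(z/z̄)^{λ} = e^{2iθλ}` (the character `(z/|z|)^{2λ}`, `2λ ∈ ℤ`), so `ρ_v(z) = diag(e^{2iθλ_i})`
depends on `θ` only and `ᵗρ_v(z̄) = ρ_v(z̄) = diag(e^{-2iθλ_i})`; the invariance for all `z ∈ ℂ^×`
is the invariance under the one-parameter torus `θ ↦ diag(e^{2iθλ_i})`, entrywise
`e^{2iθ(λ_j - λ_i)} A_{ij} = A_{ij}`. Since the `λ_{i,v}` of a C-algebraic `π` all lie in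
`(n-1)/2 + ℤ`, `λ_j - λ_i = k ∈ ℤ`, and for `k ≠ 0` the choice `θ = π/(2k)` gives `-A_{ij} = A_{ij}`:
`A` is block diagonal for the partition by the values `λ_i` — the hypothesis `hblock` of the
previous section. Combined with that section this is the printed sentence in full: such an `A`
exists at every archimedean place only in the evenly-paired configuration.
-/

section TorusInvariance

open _root_.Matrix _root_.Finset

/-- **Torus invariance forces block-diagonality.** Let `lam : ι → ℂ` have integral differences
(`λ_j - λ_i ∈ ℤ`, as for the exponents of a C-algebraic infinity type at one embedding) and let the
square matrix `A` satisfy `ᵗρ(z̄) A ρ(z) = A` for the torus `ρ(e^{iθ}) = diag(e^{2iθλ_i})`, i.e.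
`diag(e^{-2iθλ_i}) · A · diag(e^{2iθλ_i}) = A` for all real `θ`. Then `A_{ij} = 0` whenever
`λ_i ≠ λ_j`: entrywise the invariance is `e^{2iθ(λ_j-λ_i)} A_{ij} = A_{ij}`, and for
`λ_j - λ_i = k ≠ 0` the value `θ = π/(2k)` gives `e^{iπ} A_{ij} = -A_{ij} = A_{ij}`.
[cite: FakhruddinPilloni2021, Thm. 9.7 (proof, arXiv p. 44)] -/
theorem matrix_apply_eq_zero_of_torus_invariant {ι : Type*} [Fintype ι] [DecidableEq ι]
    (lam : ι → ℂ) {A : Matrix ι ι ℂ} (hint : ∀ i j, ∃ k : ℤ, lam j - lam i = k)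
    (hinv : ∀ θ : ℝ,
      (diagonal fun i => Complex.exp (-(2 * (θ : ℂ) * lam i * Complex.I))) * A *
        (diagonal fun i => Complex.exp (2 * (θ : ℂ) * lam i * Complex.I)) = A)
    (i j : ι) (hij : lam i ≠ lam j) : A i j = 0 := by
  obtain ⟨k, hk⟩ := hint i j
  have hk0 : (k : ℂ) ≠ 0 := by
    rw [← hk]
    exact sub_ne_zero.mpr (Ne.symm hij)
  have h := congr_fun (congr_fun (hinv (Real.pi / (2 * k))) i) j
  simp only [mul_diagonal, diagonal_mul] at h
  have hexp : Complex.exp (-(2 * ((Real.pi / (2 * k) : ℝ) : ℂ) * lam i * Complex.I)) *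
      Complex.exp (2 * ((Real.pi / (2 * k) : ℝ) : ℂ) * lam j * Complex.I) = -1 := by
    rw [← Complex.exp_add, ← Complex.exp_pi_mul_I]
    congr 1
    have hj : lam j = lam i + k := by rw [← hk]; ring
    rw [hj]
    push_cast
    field_simp
    ring
  have h' : -A i j = A i j := by
    calc -A i j = Complex.exp (-(2 * ((Real.pi / (2 * k) : ℝ) : ℂ) * lam i * Complex.I)) * A i j *
          Complex.exp (2 * ((Real.pi / (2 * k) : ℝ) : ℂ) * lam j * Complex.I) := by
          rw [mul_right_comm, hexp]; ring
      _ = A i j := h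
  linear_combination (-(1 : ℂ) / 2) * h'

/-- **"There is no such symplectic form, unless when `n` is even and `λ_{i,v} = λ_{i+n/2,v}` for
some ordering of the `(λ_{i,v})`"** (Fakhruddin–Pilloni, proof of Thm. 9.7, p. 44), for exponents
with integral differences: if an antisymmetric (`Aᵀ = -A`) non-degenerate (`det A ≠ 0`) matrix `A`
satisfies `ᵗρ(z̄) A ρ(z) = A` for the torus `ρ(e^{iθ}) = diag(e^{2iθλ_i})`, then the number of
indices is even and the multiset `{λ_i}_i` is a double `μ + μ`
(`matrix_apply_eq_zero_of_torus_invariant` and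
`exists_map_eq_add_self_of_transpose_eq_neg_of_det_ne_zero`).
[cite: FakhruddinPilloni2021, Thm. 9.7 (proof, arXiv p. 44)] -/
theorem even_card_and_exists_map_eq_add_self_of_torus_invariant {ι : Type*} [Fintype ι]
    [DecidableEq ι] (lam : ι → ℂ) {A : Matrix ι ι ℂ} (hA : A.transpose = -A) (hdet : A.det ≠ 0)
    (hint : ∀ i j, ∃ k : ℤ, lam j - lam i = k)
    (hinv : ∀ θ : ℝ,
      (diagonal fun i => Complex.exp (-(2 * (θ : ℂ) * lam i * Complex.I))) * A *
        (diagonal fun i => Complex.exp (2 * (θ : ℂ) * lam i * Complex.I)) = A) :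
    Even (Fintype.card ι) ∧ ∃ μ : Multiset ℂ, univ.val.map lam = μ + μ := by
  obtain ⟨μ, hμ⟩ := exists_map_eq_add_self_of_transpose_eq_neg_of_det_ne_zero lam hA hdet
    (matrix_apply_eq_zero_of_torus_invariant lam hint hinv)
  refine ⟨⟨Multiset.card μ, ?_⟩, μ, hμ⟩
  have h := congr_arg Multiset.card hμ
  rwa [Multiset.card_map, Multiset.card_add] at h

end TorusInvariance

namespace InfinityType

open _root_.Matrix _root_.Finset

variable {K : Type*} [Field K] {n : ℕ}

/-- The exponents `λ_{i,τ}` of a C-algebraic infinity type at one embedding have integral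
differences (all lie in `(n-1)/2 + ℤ`). [cite: BuzzardGee2014, Definition 3.1.1 and Definition 5.3.3] -/
theorem IsCAlgebraic.exists_int_sub {T : InfinityType K n} (hC : T.IsCAlgebraic) (σ : K →+* ℂ)
    {x y : ℂ} (hx : x ∈ (T σ).map ArchWeight.a) (hy : y ∈ (T σ).map ArchWeight.a) :
    ∃ k : ℤ, y - x = k := by
  obtain ⟨p, hp, rfl⟩ := Multiset.mem_map.mp hx
  obtain ⟨q, hq, rfl⟩ := Multiset.mem_map.mp hy
  obtain ⟨k, -, hk, -⟩ := hC σ p hp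
  obtain ⟨l, -, hl, -⟩ := hC σ q hq
  exact ⟨l - k, by rw [hk, hl]; push_cast; ring⟩

/-- **The archimedean condition of the printed proof of Thm. 9.7 forces the exceptional
configuration.** Let `T` be a C-algebraic infinity type of rank `n` over a number field `K`.
Suppose that at every complex embedding `σ` — for some enumeration `λ_1, …, λ_n` of the exponents
`λ_{i,σ}` (the multiset `(T σ).map ArchWeight.a`) and the parameter
`ρ_σ(z) = diag((z/z̄)^{λ_1}, …, (z/z̄)^{λ_n})`, realised on `z = e^{iθ}` as `diag(e^{2iθλ_i})` —
"there exists a non degenerate symplectic form `A` on `ℂⁿ` such that `ᵗρ_σ(z̄) A ρ_σ(z) = A` for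
all `z`" (an antisymmetric `A` with `det A ≠ 0` invariant under the torus). Then `n` is even and
for all `σ`, `λ_{i,σ} = λ_{i+n/2,σ}` for some ordering: `T.IsEvenlyPaired`. (This is the condition
"for `π_v` to descend via the twisted `L`-group embedding" at every `v ∣ ∞`, p. 44; a number field
has a complex embedding, whence `Even n`.) [cite: FakhruddinPilloni2021, Thm. 9.7 (proof, arXiv p. 44)] -/
theorem isEvenlyPaired_of_symplectic_torus_invariant [NumberField K] {T : InfinityType K n}
    (hC : T.IsCAlgebraic)
    (h : ∀ σ : K →+* ℂ, ∃ (lam : Fin n → ℂ) (A : Matrix (Fin n) (Fin n) ℂ),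
      univ.val.map lam = (T σ).map ArchWeight.a ∧ A.transpose = -A ∧ A.det ≠ 0 ∧
        ∀ θ : ℝ,
          (diagonal fun i => Complex.exp (-(2 * (θ : ℂ) * lam i * Complex.I))) * A *
            (diagonal fun i => Complex.exp (2 * (θ : ℂ) * lam i * Complex.I)) = A) :
    T.IsEvenlyPaired := by
  have key : ∀ σ : K →+* ℂ, Even n ∧ ∃ μ : Multiset ℂ, (T σ).map ArchWeight.a = μ + μ := by
    intro σ
    obtain ⟨lam, A, hlam, hA, hdet, hinv⟩ := h σ
    have hint : ∀ i j, ∃ k : ℤ, lam j - lam i = k := fun i j =>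
      hC.exists_int_sub σ (x := lam i) (y := lam j)
        (hlam ▸ Multiset.mem_map_of_mem _ (mem_univ_val i))
        (hlam ▸ Multiset.mem_map_of_mem _ (mem_univ_val j))
    obtain ⟨heven, μ, hμ⟩ :=
      even_card_and_exists_map_eq_add_self_of_torus_invariant lam hA hdet hint hinv
    exact ⟨by simpa using heven, μ, hlam ▸ hμ⟩
  obtain ⟨σ₀⟩ := (inferInstance : Nonempty (K →+* ℂ))
  exact ⟨(key σ₀).1, fun σ => (key σ).2⟩

end InfinityType

/-! ### Raw pole plus dichotomy gives the continued pole (pointwise converse bridge) -/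

section ConverseBridge

open Filter
open scoped Classical

variable {F E : Type} [Field F] [NumberField F] [Field E] [NumberField E] [Algebra F E]
  {N : ℕ} {hcpt : isCompact_glFiniteIntegralLevel N E}
  {π : AutomorphicRepData (AutomorphyDatum.gl N E hcpt)} {c : E ≃ₐ[F] E} {η : ℤˣ}

/-- **A raw pole is the continued pole, granted the dichotomy for the datum.** Let `(S, A)` be an
Asai datum of `π` whose raw partial `As^η` product is holomorphic on `{1 < Re s}` and satisfies the
raw-limit pole `π.HasAsaiPole c η`. If the datum satisfies the corrected dichotomy (verbatim the
conclusion, for this datum, of the hypothesis `h` of `Mok2014_partialAsaiL_pole_dichotomy_of_continuation`: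
some sign `η₀` and `σ₀ ≥ 1` with both products multipliable on `Re s > σ₀`, a continuation `G` of
`(s - 1) L^S(s, Π, As^{η₀})` holomorphic on `{1/2 < Re s}` with `G(1) ≠ 0`, and a continuation `H` of
`L^S(s, Π, As^{-η₀})` holomorphic on `{1/2 < Re s}`), then `η₀ = η` — the sign `-η` is excluded by
`HasAsaiPole.false_of_holomorphic_continuation` — so the CONTINUED `L^S(s, Π, As^η)` has the simple
pole at `s = 1` (with the product multipliable on `Re s > σ₀`). [folklore] -/
theorem AutomorphicRepData.HasAsaiPole.exists_continuation_of_dichotomy (hpole : π.HasAsaiPole c η)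
    {S : Set (HeightOneSpectrum (𝓞 F))} {A : SatakeFamily E} (hSA : π.IsAsaiDatum c S A)
    (hhol : DifferentiableOn ℂ (partialAsaiL S c A η) {s : ℂ | 1 < s.re})
    (hdich : ∃ (η₀ : ℤˣ) (σ₀ : ℝ), 1 ≤ σ₀ ∧
      (∀ (θ : ℤˣ) (s : ℂ), σ₀ < s.re →
        Multipliable fun v : {v : HeightOneSpectrum (𝓞 F) // v ∉ S} =>
          ((asaiLocalPolynomial c A θ (placeAbove E v.1)).eval ((v.1.residueCard : ℂ) ^ (-s)))⁻¹) ∧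
      (∃ G : ℂ → ℂ, DifferentiableOn ℂ G {s : ℂ | 1 / 2 < s.re} ∧
        (∀ s : ℂ, σ₀ < s.re → G s = (s - 1) * partialAsaiL S c A η₀ s) ∧ G 1 ≠ 0) ∧
      (∃ H : ℂ → ℂ, DifferentiableOn ℂ H {s : ℂ | 1 / 2 < s.re} ∧
        (∀ s : ℂ, σ₀ < s.re → H s = partialAsaiL S c A (-η₀) s))) :
    ∃ σ₀ : ℝ, 1 ≤ σ₀ ∧
      (∀ s : ℂ, σ₀ < s.re →
        Multipliable fun v : {v : HeightOneSpectrum (𝓞 F) // v ∉ S} =>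
          ((asaiLocalPolynomial c A η (placeAbove E v.1)).eval ((v.1.residueCard : ℂ) ^ (-s)))⁻¹) ∧
      ∃ G : ℂ → ℂ, DifferentiableOn ℂ G {s : ℂ | 1 / 2 < s.re} ∧
        (∀ s : ℂ, σ₀ < s.re → G s = (s - 1) * partialAsaiL S c A η s) ∧ G 1 ≠ 0 := by
  obtain ⟨η₀, σ₀, hσ₀, hmult, ⟨G, hG, hGL, hG1⟩, ⟨H, hH, hHL⟩⟩ := hdich
  by_cases hη : η₀ = η
  · subst hη
    exact ⟨σ₀, hσ₀, fun s hs => hmult _ s hs, G, hG, hGL, hG1⟩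
  · have hneg : -η₀ = η := by rw [Int.units_ne_iff_eq_neg.mp hη, neg_neg]
    exact (hpole.false_of_holomorphic_continuation hSA hhol hσ₀ hH
      (fun s hs => by rw [hHL s hs, hneg])).elim

end ConverseBridge

/-! ### The corrected Theorem 9.7 and the mis-stated rendering -/

section Corrected

open scoped Classical

/-- **Corrected Thm. 9.7 + raw holomorphy ⇒ the mis-stated rendering.** The corrected Theorem 9.7
(hypothesis `h97`, module docstring: conclusion "odd" as a simple pole at `s = 1` of the CONTINUED
partial Asai `L`-functions `L^S(s, π, As^{(-1)^{n-1}})`, for every Asai datum) together with the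
holomorphy, on the open half-plane `{1 < Re s}`, of the raw partial `As^{(-1)^{n-1}}` Euler products
of every conjugate self-dual cuspidal `π` over a CM field (hypothesis `hhol` — the unpublished
convergence statement isolated in `AsaiSignContinuation`, a consequence of the Ramanujan conjecture
for `π`) implies the rendering `FakhruddinPilloni2021_odd_of_weaklyRegular` verbatim
(`AutomorphicRepData.hasAsaiPole_of_continuation`: on `{1 < Re s}` the raw product coincides with its
continuation). [cite: FakhruddinPilloni2021, Thm. 9.7 (arXiv p. 43) and §9.1 (Odd, p. 41)] -/
theorem FakhruddinPilloni2021_odd_of_weaklyRegular_of_oddCont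
    (h97 : ∀ (n : ℕ) (K : Type) [Field K] [NumberField K] [IsCMField K]
      (hcpt : isCompact_glFiniteIntegralLevel n K) (π : CuspidalAutomorphicRepData n K hcpt)
      (T : InfinityType K n), π.1.HasInfinityType T → T.IsCAlgebraic → T.IsWeaklyRegular →
        π.1.IsEssConjSelfDual 1 →
          (∀ (S : Set (HeightOneSpectrum (𝓞 (maximalRealSubfield K)))) (A : SatakeFamily K),
              π.1.IsAsaiDatum (IsCMField.complexConj K) S A →
                ∃ σ₀ : ℝ, 1 ≤ σ₀ ∧
                  (∀ s : ℂ, σ₀ < s.re →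
                    Multipliable fun v : {v : HeightOneSpectrum (𝓞 (maximalRealSubfield K)) // v ∉ S} =>
                      ((asaiLocalPolynomial (IsCMField.complexConj K) A ((-1) ^ (n + 1))
                        (placeAbove K v.1)).eval ((v.1.residueCard : ℂ) ^ (-s)))⁻¹) ∧
                  ∃ G : ℂ → ℂ, DifferentiableOn ℂ G {s : ℂ | 1 / 2 < s.re} ∧
                    (∀ s : ℂ, σ₀ < s.re → G s =
                      (s - 1) * partialAsaiL S (IsCMField.complexConj K) A ((-1) ^ (n + 1)) s) ∧
                    G 1 ≠ 0) ∨
            T.IsEvenlyPaired)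
    (hhol : ∀ (n : ℕ) (K : Type) [Field K] [NumberField K] [IsCMField K]
      (hcpt : isCompact_glFiniteIntegralLevel n K) (π : CuspidalAutomorphicRepData n K hcpt),
      π.1.IsEssConjSelfDual 1 →
        ∀ (S : Set (HeightOneSpectrum (𝓞 (maximalRealSubfield K)))) (A : SatakeFamily K),
          π.1.IsAsaiDatum (IsCMField.complexConj K) S A →
            DifferentiableOn ℂ (partialAsaiL S (IsCMField.complexConj K) A ((-1) ^ (n + 1)))
              {s : ℂ | 1 < s.re}) :
    FakhruddinPilloni2021_odd_of_weaklyRegular := by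
  intro n K _ _ _ hcpt π T hT hC hW hsd
  rcases h97 n K hcpt π T hT hC hW hsd with hodd | hpair
  · refine Or.inl ?_
    rw [AutomorphicRepData.hasAsaiSign_iff, mul_one]
    exact AutomorphicRepData.hasAsaiPole_of_continuation
      (fun S A hSA => hhol n K hcpt π hsd S A hSA)
      fun S A hSA => by
        obtain ⟨σ₀, hσ₀, -, hG⟩ := hodd S A hSA
        exact ⟨σ₀, hσ₀, hG⟩
  · exact Or.inr hpair

/-- **Corrected Thm. 9.7, pointwise, for `π` satisfying the Ramanujan bound — unconditionally in the
raw currency.** If the corrected Theorem 9.7 holds (`h97`) and the Satake parameters of `π` at its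
unramified places have norm `≤ 1`, then `π` is odd in the raw-limit sense `HasAsaiSign π c 1` of the
rendering, or its infinity type is evenly paired: the raw partial Asai products of such a `π` are
holomorphic on `{1 < Re s}` (`AutomorphicRepData.hasAsaiPole_of_continuation_of_norm_le_one`).
[cite: FakhruddinPilloni2021, Thm. 9.7 (arXiv p. 43)] -/
theorem hasAsaiSign_or_isEvenlyPaired_of_oddCont_of_norm_le_one
    (h97 : ∀ (n : ℕ) (K : Type) [Field K] [NumberField K] [IsCMField K]
      (hcpt : isCompact_glFiniteIntegralLevel n K) (π : CuspidalAutomorphicRepData n K hcpt)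
      (T : InfinityType K n), π.1.HasInfinityType T → T.IsCAlgebraic → T.IsWeaklyRegular →
        π.1.IsEssConjSelfDual 1 →
          (∀ (S : Set (HeightOneSpectrum (𝓞 (maximalRealSubfield K)))) (A : SatakeFamily K),
              π.1.IsAsaiDatum (IsCMField.complexConj K) S A →
                ∃ σ₀ : ℝ, 1 ≤ σ₀ ∧
                  (∀ s : ℂ, σ₀ < s.re →
                    Multipliable fun v : {v : HeightOneSpectrum (𝓞 (maximalRealSubfield K)) // v ∉ S} =>
                      ((asaiLocalPolynomial (IsCMField.complexConj K) A ((-1) ^ (n + 1))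
                        (placeAbove K v.1)).eval ((v.1.residueCard : ℂ) ^ (-s)))⁻¹) ∧
                  ∃ G : ℂ → ℂ, DifferentiableOn ℂ G {s : ℂ | 1 / 2 < s.re} ∧
                    (∀ s : ℂ, σ₀ < s.re → G s =
                      (s - 1) * partialAsaiL S (IsCMField.complexConj K) A ((-1) ^ (n + 1)) s) ∧
                    G 1 ≠ 0) ∨
            T.IsEvenlyPaired)
    {n : ℕ} {K : Type} [Field K] [NumberField K] [IsCMField K]
    {hcpt : isCompact_glFiniteIntegralLevel n K} (π : CuspidalAutomorphicRepData n K hcpt)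
    {T : InfinityType K n} (hT : π.1.HasInfinityType T) (hC : T.IsCAlgebraic)
    (hW : T.IsWeaklyRegular) (hsd : π.1.IsEssConjSelfDual 1)
    (htemp : ∀ (w : HeightOneSpectrum (𝓞 K)) (α : Multiset ℂ), π.1.HasSatakeParamAt w α →
      ∀ a ∈ α, ‖a‖ ≤ 1) :
    π.1.HasAsaiSign (IsCMField.complexConj K) 1 ∨ T.IsEvenlyPaired := by
  rcases h97 n K hcpt π T hT hC hW hsd with hodd | hpair
  · refine Or.inl ?_
    rw [AutomorphicRepData.hasAsaiSign_iff, mul_one]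
    exact AutomorphicRepData.hasAsaiPole_of_continuation_of_norm_le_one htemp fun S A hSA => by
      obtain ⟨σ₀, hσ₀, -, hG⟩ := hodd S A hSA
      exact ⟨σ₀, hσ₀, hG⟩
  · exact Or.inr hpair

/-- **The mis-stated rendering gives back the corrected conclusion, for `π` with holomorphic raw
products satisfying the dichotomy** (converse of `FakhruddinPilloni2021_odd_of_weaklyRegular_of_oddCont`,
pointwise). Assume the rendering `FakhruddinPilloni2021_odd_of_weaklyRegular`. Let `π` satisfy its
hypotheses, and suppose that for every Asai datum of `π` the raw partial `As^{(-1)^{n-1}}` product is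
holomorphic on `{1 < Re s}` and the datum satisfies the corrected dichotomy (per datum, verbatim the
conclusion of the hypothesis `h` of `Mok2014_partialAsaiL_pole_dichotomy_of_continuation`). Then the
conclusion of the corrected Thm. 9.7 holds for `π`: the continued `L^S(s, π, As^{(-1)^{n-1}})` has a
simple pole at `s = 1` for every Asai datum, or `T` is evenly paired
(`AutomorphicRepData.HasAsaiPole.exists_continuation_of_dichotomy`).
[cite: FakhruddinPilloni2021, Thm. 9.7 (arXiv p. 43)] [cite: Mok2014, §2.5 and Thm. 2.5.4 (a)] -/
theorem oddCont_or_isEvenlyPaired_of_odd (h : FakhruddinPilloni2021_odd_of_weaklyRegular)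
    {n : ℕ} {K : Type} [Field K] [NumberField K] [IsCMField K]
    {hcpt : isCompact_glFiniteIntegralLevel n K} (π : CuspidalAutomorphicRepData n K hcpt)
    {T : InfinityType K n} (hT : π.1.HasInfinityType T) (hC : T.IsCAlgebraic)
    (hW : T.IsWeaklyRegular) (hsd : π.1.IsEssConjSelfDual 1)
    (hhol : ∀ (S : Set (HeightOneSpectrum (𝓞 (maximalRealSubfield K)))) (A : SatakeFamily K),
      π.1.IsAsaiDatum (IsCMField.complexConj K) S A →
        DifferentiableOn ℂ (partialAsaiL S (IsCMField.complexConj K) A ((-1) ^ (n + 1)))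
          {s : ℂ | 1 < s.re})
    (hdich : ∀ (S : Set (HeightOneSpectrum (𝓞 (maximalRealSubfield K)))) (A : SatakeFamily K),
      π.1.IsAsaiDatum (IsCMField.complexConj K) S A →
        ∃ (η₀ : ℤˣ) (σ₀ : ℝ), 1 ≤ σ₀ ∧
          (∀ (θ : ℤˣ) (s : ℂ), σ₀ < s.re →
            Multipliable fun v : {v : HeightOneSpectrum (𝓞 (maximalRealSubfield K)) // v ∉ S} =>
              ((asaiLocalPolynomial (IsCMField.complexConj K) A θ (placeAbove K v.1)).eval
                ((v.1.residueCard : ℂ) ^ (-s)))⁻¹) ∧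
          (∃ G : ℂ → ℂ, DifferentiableOn ℂ G {s : ℂ | 1 / 2 < s.re} ∧
            (∀ s : ℂ, σ₀ < s.re →
              G s = (s - 1) * partialAsaiL S (IsCMField.complexConj K) A η₀ s) ∧ G 1 ≠ 0) ∧
          (∃ H : ℂ → ℂ, DifferentiableOn ℂ H {s : ℂ | 1 / 2 < s.re} ∧
            (∀ s : ℂ, σ₀ < s.re → H s = partialAsaiL S (IsCMField.complexConj K) A (-η₀) s))) :
    (∀ (S : Set (HeightOneSpectrum (𝓞 (maximalRealSubfield K)))) (A : SatakeFamily K),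
        π.1.IsAsaiDatum (IsCMField.complexConj K) S A →
          ∃ σ₀ : ℝ, 1 ≤ σ₀ ∧
            (∀ s : ℂ, σ₀ < s.re →
              Multipliable fun v : {v : HeightOneSpectrum (𝓞 (maximalRealSubfield K)) // v ∉ S} =>
                ((asaiLocalPolynomial (IsCMField.complexConj K) A ((-1) ^ (n + 1))
                  (placeAbove K v.1)).eval ((v.1.residueCard : ℂ) ^ (-s)))⁻¹) ∧
            ∃ G : ℂ → ℂ, DifferentiableOn ℂ G {s : ℂ | 1 / 2 < s.re} ∧
              (∀ s : ℂ, σ₀ < s.re → G s =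
                (s - 1) * partialAsaiL S (IsCMField.complexConj K) A ((-1) ^ (n + 1)) s) ∧
              G 1 ≠ 0) ∨
      T.IsEvenlyPaired := by
  rcases h n K hcpt π T hT hC hW hsd with hodd | hpair
  · refine Or.inl fun S A hSA => ?_
    have hpole : π.1.HasAsaiPole (IsCMField.complexConj K) ((-1) ^ (n + 1)) := by
      simpa only [AutomorphicRepData.hasAsaiSign_iff, mul_one] using hodd
    exact hpole.exists_continuation_of_dichotomy hSA (hhol S A hSA) (hdich S A hSA)
  · exact Or.inr hpair

/-- **Corrected Thm. 9.7 (hypothesis `h97`) + vendored Thm. 9.10 under an odd-multiplicity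
exponent.** For `K` CM and `π` cuspidal, conjugate self-dual, with a C-algebraic weakly regular
infinity type having at some embedding an exponent of odd multiplicity, and whose raw partial
`As^{(-1)^{n-1}}` Euler products (every Asai datum) are holomorphic on `{1 < Re s}` (the hypothesis
bridging the printed oddness to the raw-limit oddness ASSUMED by the rendering
`FakhruddinPilloni2021_galoisRep_of_weaklyRegular_odd` of Thm. 9.10), the Galois representations of
Thm. 9.10 exist — the composite `FakhruddinPilloni2021_galoisRep_of_odd_count` re-based on the
printed Thm. 9.7. [cite: FakhruddinPilloni2021, Thm. 9.7 and Thm. 9.10 (arXiv pp. 43–44)] -/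
theorem FakhruddinPilloni2021_galoisRep_of_odd_count_of_oddCont
    (h97 : ∀ (n : ℕ) (K : Type) [Field K] [NumberField K] [IsCMField K]
      (hcpt : isCompact_glFiniteIntegralLevel n K) (π : CuspidalAutomorphicRepData n K hcpt)
      (T : InfinityType K n), π.1.HasInfinityType T → T.IsCAlgebraic → T.IsWeaklyRegular →
        π.1.IsEssConjSelfDual 1 →
          (∀ (S : Set (HeightOneSpectrum (𝓞 (maximalRealSubfield K)))) (A : SatakeFamily K),
              π.1.IsAsaiDatum (IsCMField.complexConj K) S A →
                ∃ σ₀ : ℝ, 1 ≤ σ₀ ∧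
                  (∀ s : ℂ, σ₀ < s.re →
                    Multipliable fun v : {v : HeightOneSpectrum (𝓞 (maximalRealSubfield K)) // v ∉ S} =>
                      ((asaiLocalPolynomial (IsCMField.complexConj K) A ((-1) ^ (n + 1))
                        (placeAbove K v.1)).eval ((v.1.residueCard : ℂ) ^ (-s)))⁻¹) ∧
                  ∃ G : ℂ → ℂ, DifferentiableOn ℂ G {s : ℂ | 1 / 2 < s.re} ∧
                    (∀ s : ℂ, σ₀ < s.re → G s =
                      (s - 1) * partialAsaiL S (IsCMField.complexConj K) A ((-1) ^ (n + 1)) s) ∧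
                    G 1 ≠ 0) ∨
            T.IsEvenlyPaired)
    (h910 : FakhruddinPilloni2021_galoisRep_of_weaklyRegular_odd)
    {n : ℕ} {K : Type} [Field K] [NumberField K] [IsCMField K]
    {hcpt : isCompact_glFiniteIntegralLevel n K} (π : CuspidalAutomorphicRepData n K hcpt)
    {T : InfinityType K n} (hT : π.1.HasInfinityType T) (hC : T.IsCAlgebraic)
    (hW : T.IsWeaklyRegular) {σ : K →+* ℂ} {a : ℂ}
    (hodd : Odd (((T σ).map ArchWeight.a).count a)) (hsd : π.1.IsEssConjSelfDual 1)
    (hhol : ∀ (S : Set (HeightOneSpectrum (𝓞 (maximalRealSubfield K)))) (A : SatakeFamily K),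
      π.1.IsAsaiDatum (IsCMField.complexConj K) S A →
        DifferentiableOn ℂ (partialAsaiL S (IsCMField.complexConj K) A ((-1) ^ (n + 1)))
          {s : ℂ | 1 < s.re})
    (ℓ : ℕ) [Fact ℓ.Prime] (ι : PadicAlgCl ℓ ≃+* ℂ) :
    ∃ r : GaloisRepresentations.FramedGaloisRep K (PadicAlgCl ℓ) n,
      ∀ (v : HeightOneSpectrum (𝓞 K)) (α : Multiset ℂ), π.1.HasSatakeParamAt v α →
        ((ℓ : ℕ) : 𝓞 K) ∉ v.asIdeal →
          r.IsUnramifiedAt v ∧ r.HasFrobCharpolyAt v (arithFrobPolyOfSatake ι v.residueCard n α) := by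
  have hodd' : π.1.HasAsaiSign (IsCMField.complexConj K) 1 := by
    rcases h97 n K hcpt π T hT hC hW hsd with h | h
    · rw [AutomorphicRepData.hasAsaiSign_iff, mul_one]
      exact AutomorphicRepData.hasAsaiPole_of_continuation (fun S A hSA => hhol S A hSA)
        fun S A hSA => by
          obtain ⟨σ₀, hσ₀, -, hG⟩ := h S A hSA
          exact ⟨σ₀, hσ₀, hG⟩
    · exact absurd h (InfinityType.not_isEvenlyPaired_of_odd_count hodd)
  exact h910 n K hcpt π T hT hC hW hsd hodd' ℓ ι

end Corrected

end Literature.NumberTheory.Automorphic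

end
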